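import Summits.KontsevichZagierPeriods.KontsevichZagierPeriods.Theorems.HermiteRigidityReductionRigidityNeumannTransfer
import Summits.KontsevichZagierPeriods.KontsevichZagierPeriods.Theorems.HermiteRigidityReductionRigidityCarrierDivisible
import Summits.KontsevichZagierPeriods.KontsevichZagierPeriods.Theorems.HermiteRigidityReductionRigidityDilogSectorPresentation
import Literature.NumberTheory.Transcendental.KZVolumeConjectureProofs

/-!
# `ReductionRigidity` (stmt-KontsevichZagierPeriods-3407), line `Sketch`, growth line
# `bloch-suslin-rational-dilog`: III — `DehnClosedReduces` and THE RATIONAL DILOGARITHM ISLAND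

Route `KontsevichZagierPeriods/HermiteRigidity`, crux `ReductionRigidity` (stmt-3407, summit-equivalent; skeleton
`Cruxes/ReductionRigidity/Lines/Sketch.lean` v7). Lead seat c6; registered sub-goal stubs `stub_dehnClosedReduces`,
`stub_rationalDilogIsland` — the two consequences of the real five-term transfer (`stub_neumannTransfer`, part II) that the
crux idea card `Cruxes/ReductionRigidity/Ideas/bloch-suslin-rational-dilog.md` and the census companion
`StrategySketchS1.lean` §T ask for:
* `stub_dehnClosedReduces` — over the tree's named fact `Suslin1991_blochGroupRatTorsion` (the Bloch group of `ℚ` is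
  torsion: Suslin 1991 Thm. 5.2 + `K₃(ℚ) = ℤ/48`), EVERY DEHN-CLOSED `ℤ`-COMBINATION OF RATIONAL DILOGARITHM SYMBOLS
  `Σ nᵢ [□², xᵢ/(1 − xᵢpq)]` (`xᵢ ∈ ℚ`, `xᵢ < 1`, `xᵢ ≠ 0`, any representations) LIES IN `KZ.relations ⊔ ⟨carriers⟩`: it
  reduces BY MOVES to weight `≤ 1` (products of two logarithms and the `ζ(2)`-line) — the REDUCTION half of Conjecture 1 of
  Kontsevich–Zagier on the rational dilogarithm sector (Suslin gives `M•ξ ∈ ⟨five-term⟩`, the transfer kills it, `M` is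
  removed by `stub_carrierDivisible` and the torsion-freeness of `FormalRep ⧸ relations`);
* `stub_rationalDilogIsland` — CONJECTURE 1 IN KERNEL FORM on the sector generated by ALL rational dilogarithm symbols and
  the carriers (every level at once; the alternating and negative arguments included), from Suslin and the INLINED
  RIGIDITY `R₂(ℚ)` in two halves (open; the weight-two real part of the period conjecture for `ℚ`, named not attacked,
  as `padeBoxKernelTwo` inlines Viola–Zudilin/Nikišin and the elliptic cruxes inline Masser): (a) a vanishing value of
  "symbols + carrier" forces the Bloch symbol of the symbol part to vanish rationally, (b) the kernel form on the carriers.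

References: A. A. Suslin, *K₃ of a field and the Bloch group* (1991), Thm. 5.2 [cite: Suslin1991, Thm. 5.2];
K. Hutchinson, arXiv:1107.0264, §2.2, §5 [cite: Hutchinson2011, §2.2 and §5]; D. Zagier, *The dilogarithm function* (2007),
Ch. I §§2, 5 [cite: Zagier2007Dilogarithm, Ch. I §2]; M. Kontsevich, D. Zagier, *Periods* (2001), §1.2
[cite: KontsevichZagier2001, §1.2]. No definitions are introduced.
-/

noncomputable section

open MeasureTheory Set MvPolynomial

namespace Summit.KontsevichZagierPeriods.HermiteRigidity.ReductionRigidity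

open Literature.NumberTheory.Transcendental
open Literature.NumberTheory.Transcendental.KZ

/-- The rational dilogarithm symbol `[□², z/(1 − z p₀p₁)]` exists as a regular rational representation on the
closed square for every rational `z < 1`. [cite: KontsevichZagier2001, §1.1] -/
theorem exists_dilogRep (z : ℚ) (hz : z < 1) : ∃ r : IntegralRep 2, r.domain = cube 2 ∧
    EqOn r.integrand (fun p => (z : ℝ) / (1 - (z : ℝ) * p 0 * p 1)) (cube 2) := by
  have hden : ∀ x ∈ cube 2, aeval x ((1 - C z * X 0 * X 1 : MvPolynomial (Fin 2) ℚ)) ≠ 0 := by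
    intro x hx
    simp only [map_sub, map_one, map_mul, aeval_C, aeval_X, eq_ratCast]
    have h0 : 0 ≤ x 0 * x 1 := mul_nonneg (hx 0).1 (hx 1).1
    have h1 : x 0 * x 1 ≤ 1 := mul_le_one₀ (hx 0).2 (hx 1).1 (hx 1).2
    have hz' : (z : ℝ) < 1 := by exact_mod_cast hz
    rcases le_or_gt (z : ℝ) 0 with hz0 | hz0
    · nlinarith [mul_nonneg (neg_nonneg.2 hz0) h0]
    · nlinarith [mul_le_mul_of_nonneg_left h1 hz0.le]
  refine ⟨(⟨C z, _, hden⟩ : RFun 2).rep, rfl, fun x _ => ?_⟩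
  simp [RFun.rep_integrand, RFun.fn, mul_assoc]


/-- **`DehnClosedReduces` for the realisation `B`** (over Suslin's theorem `B(ℚ)` torsion, the tree's named fact
`Suslin1991_blochGroupRatTorsion`): a rational combination `ξ = Σ nᵢ[zᵢ]` with vanishing Bloch symbol is sent by
the real-period realisation into `KZ.relations ⊔ ⟨carriers⟩` — Suslin gives `M•ξ ∈ ⟨five-term⟩`, the transfer
kills it, and `M` is removed because the carrier sector is divisible modulo moves (`stub_carrierDivisible`) and
`FormalRep ⧸ relations` is torsion-free. [cite: Suslin1991, Thm. 5.2] [cite: KontsevichZagier2001, §1.2] -/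
theorem dehnClosed_lift_mem (hS : Suslin1991_blochGroupRatTorsion) (ρ : ℚ → IntegralRep 2)
    (hρ : ∀ z : ℚ, z < 1 → z ≠ 0 → (ρ z).domain = cube 2 ∧
      EqOn (ρ z).integrand (fun p => (z : ℝ) / (1 - (z : ℝ) * p 0 * p 1)) (cube 2))
    (ξ : FreeAbelianGroup (PreBloch.Gen ℚ)) (hξ : ∀ u v : Additive ℚˣ →+ ℚ, blochPairing u v ξ = 0) :
    FreeAbelianGroup.lift (fun g : PreBloch.Gen ℚ =>
        if g.val < 1 then KZ.of (ρ g.val) else -KZ.of (ρ g.val⁻¹)) ξ ∈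
      KZ.relations ⊔ AddSubgroup.closure
        ({c | ∃ (r : IntegralRep 2) (e α β γ δ : ℚ), 0 < α ∧ 0 < α + β ∧ 0 < γ ∧ 0 < γ + δ ∧
            r.domain = cube 2 ∧
            EqOn r.integrand (fun p => (e : ℝ) / (((α : ℝ) + β * p 0) * ((γ : ℝ) + δ * p 1))) (cube 2) ∧
            c = KZ.of r} ∪
          {c | ∃ (r : IntegralRep 2) (e : ℚ), r.domain = cube 2 ∧
            EqOn r.integrand (fun p => (e : ℝ) / (1 + p 0 * p 1)) (cube 2) ∧ c = KZ.of r}) := by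
  obtain ⟨M, hM, hmem⟩ := hS ξ hξ
  have h := stub_neumannTransfer ρ hρ (M • ξ) hmem
  rw [map_nsmul] at h
  obtain ⟨y, hy, w, hw, hyw⟩ := AddSubgroup.mem_sup.1 h
  obtain ⟨w', hw', hww'⟩ := stub_carrierDivisible M hM w hw
  set L := FreeAbelianGroup.lift (fun g : PreBloch.Gen ℚ =>
    if g.val < 1 then KZ.of (ρ g.val) else -KZ.of (ρ g.val⁻¹)) ξ with hL
  have hM' : M • (L - w') ∈ KZ.relations := by
    have : M • (L - w') = y + (w - M • w') := by rw [nsmul_sub, ← hyw]; abel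
    rw [this]
    exact KZ.relations.add_mem hy hww'
  have h1 := Summit.KontsevichZagierPeriods.MzvKernelInKZ.Negative.mem_relations_of_nsmul_mem hM hM'
  have : L = (L - w') + w' := by abel
  rw [this]
  exact (KZ.relations ⊔ _).add_mem (AddSubgroup.mem_sup_left h1) (AddSubgroup.mem_sup_right hw')

/-- **Registered stub `stub_dehnClosedReduces` — `DehnClosedReduces`** in the finite-family form of the crux idea card (growth line
`bloch-suslin-rational-dilog`, `Cruxes/ReductionRigidity/StrategySketchS1.lean` §T): for rational `xᵢ < 1`,
`xᵢ ≠ 0`, integers `nᵢ` and ANY representations `rᵢ` of the symbols `[□², xᵢ/(1 − xᵢ p₀p₁)]`, if the Bloch symbol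
`Σ nᵢ xᵢ ∧ (1 − xᵢ)` vanishes rationally then `Σ nᵢ [rᵢ]` lies in `KZ.relations ⊔ ⟨carriers⟩`: every Dehn-closed
rational dilogarithm combination REDUCES BY MOVES to weight `≤ 1` (products of two logarithms and the `ζ(2)`-line)
— the reduction half of Conjecture 1 on the rational dilogarithm sector, over Suslin's theorem.
[cite: Suslin1991, Thm. 5.2] [cite: Zagier2007Dilogarithm, Ch. I §2] [cite: KontsevichZagier2001, §1.2] -/
theorem stub_dehnClosedReduces : Suslin1991_blochGroupRatTorsion →
    ∀ (k : ℕ) (x : Fin k → ℚ) (n : Fin k → ℤ) (r : Fin k → IntegralRep 2) (hx : ∀ i, x i < 1 ∧ x i ≠ 0),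
      (∀ i, (r i).domain = cube 2 ∧
        EqOn (r i).integrand (fun p => (x i : ℝ) / (1 - (x i : ℝ) * p 0 * p 1)) (cube 2)) →
      (∀ u v : Additive ℚˣ →+ ℚ, blochPairing u v
        (∑ i, n i • FreeAbelianGroup.of (⟨x i, (hx i).2, (hx i).1.ne⟩ : PreBloch.Gen ℚ)) = 0) →
      (∑ i, n i • KZ.of (r i)) ∈ KZ.relations ⊔ AddSubgroup.closure
        ({c | ∃ (r : IntegralRep 2) (e α β γ δ : ℚ), 0 < α ∧ 0 < α + β ∧ 0 < γ ∧ 0 < γ + δ ∧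
            r.domain = cube 2 ∧
            EqOn r.integrand (fun p => (e : ℝ) / (((α : ℝ) + β * p 0) * ((γ : ℝ) + δ * p 1))) (cube 2) ∧
            c = KZ.of r} ∪
          {c | ∃ (r : IntegralRep 2) (e : ℚ), r.domain = cube 2 ∧
            EqOn r.integrand (fun p => (e : ℝ) / (1 + p 0 * p 1)) (cube 2) ∧ c = KZ.of r}) := by
  classical
  intro hS k x n r hx hr hdehn
  -- a global family of symbol representations
  let ρ : ℚ → IntegralRep 2 := fun z =>
    if hz : z < 1 then Classical.choose (exists_dilogRep z hz) else Classical.choose (exists_dilogRep 0 one_pos)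
  have hρ : ∀ z : ℚ, z < 1 → z ≠ 0 → (ρ z).domain = cube 2 ∧
      EqOn (ρ z).integrand (fun p => (z : ℝ) / (1 - (z : ℝ) * p 0 * p 1)) (cube 2) := by
    intro z hz _
    simp only [ρ, dif_pos hz]
    exact Classical.choose_spec (exists_dilogRep z hz)
  have hL := dehnClosed_lift_mem hS ρ hρ _ hdehn
  have key : FreeAbelianGroup.lift (fun g : PreBloch.Gen ℚ =>
        if g.val < 1 then KZ.of (ρ g.val) else -KZ.of (ρ g.val⁻¹))
      (∑ i, n i • FreeAbelianGroup.of (⟨x i, (hx i).2, (hx i).1.ne⟩ : PreBloch.Gen ℚ)) =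
      ∑ i, n i • (if x i < 1 then KZ.of (ρ (x i)) else -KZ.of (ρ (x i)⁻¹)) := by
    rw [map_sum]
    refine Finset.sum_congr rfl fun i _ => ?_
    erw [AddMonoidHom.map_zsmul, FreeAbelianGroup.lift_apply_of]
    rfl
  rw [key] at hL
  -- compare the chosen representations with the given ones
  have hcomp : ∀ i, (if x i < 1 then KZ.of (ρ (x i)) else -KZ.of (ρ (x i)⁻¹)) - KZ.of (r i) ∈ KZ.relations := by
    intro i
    rw [if_pos (hx i).1]
    refine of_sub_of_mem_relations_of_eqOn ((hr i).1.trans (hρ (x i) (hx i).1 (hx i).2).1.symm) ?_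
    intro p hp
    rw [(hρ (x i) (hx i).1 (hx i).2).1] at hp
    rw [(hρ (x i) (hx i).1 (hx i).2).2 hp, (hr i).2 hp]
  have hdiff : (∑ i, n i • (if x i < 1 then KZ.of (ρ (x i)) else -KZ.of (ρ (x i)⁻¹))) -
      ∑ i, n i • KZ.of (r i) ∈ KZ.relations := by
    rw [← Finset.sum_sub_distrib]
    refine KZ.relations.sum_mem fun i _ => ?_
    rw [← zsmul_sub]
    exact KZ.relations.zsmul_mem (hcomp i) _
  have : ∑ i, n i • KZ.of (r i) = (∑ i, n i • (if x i < 1 then KZ.of (ρ (x i)) else -KZ.of (ρ (x i)⁻¹))) -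
      ((∑ i, n i • (if x i < 1 then KZ.of (ρ (x i)) else -KZ.of (ρ (x i)⁻¹))) - ∑ i, n i • KZ.of (r i)) := by
    abel
  rw [this]
  exact (KZ.relations ⊔ _).sub_mem hL (AddSubgroup.mem_sup_left hdiff)

/-- **Registered stub `stub_rationalDilogIsland` — THE RATIONAL DILOGARITHM ISLAND** (growth line `bloch-suslin-rational-dilog` of crux `ReductionRigidity`):
Conjecture 1 of Kontsevich–Zagier in KERNEL FORM on the sector of the formal group generated by ALL rational
dilogarithm symbols `[□², z/(1 − z p₀p₁)]` (`z ∈ ℚ`, `z < 1`, `z ≠ 0`: every level at once, the alternating and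
negative arguments included) and the weight-`≤ 1` carriers — every `ℤ`-combination of value `0` is a chain of
moves — from THREE named inputs: Suslin's theorem (`B(ℚ)` is torsion; tree fact), and the two halves of the
INLINED RIGIDITY `R₂(ℚ)` of the sector (open; the weight-two real part of the period conjecture for `ℚ`, named
not attacked, as the Padé islands inline Nikišin and the elliptic cruxes inline Masser): (a) `hrigA` — a vanishing
value of "symbols + carrier" forces the Bloch symbol of the symbol part to vanish rationally; (b) `hrigW` — the
kernel form on the carrier sector (`log a·log b`, `ζ(2)`: quadratic independence of logarithms of rationals).
The REDUCTION is unconditional given Suslin: `stub_dehnClosedReduces`. [cite: KontsevichZagier2001, §1.2]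
[cite: Suslin1991, Thm. 5.2] [cite: Zagier2007Dilogarithm, Ch. I §5] -/
theorem stub_rationalDilogIsland : Suslin1991_blochGroupRatTorsion →
    (∀ (k : ℕ) (x : Fin k → ℚ) (n : Fin k → ℤ) (r : Fin k → IntegralRep 2)
      (hx : ∀ i, x i < 1 ∧ x i ≠ 0), (∀ i, (r i).domain = cube 2 ∧
        EqOn (r i).integrand (fun p => (x i : ℝ) / (1 - (x i : ℝ) * p 0 * p 1)) (cube 2)) →
      ∀ w ∈ AddSubgroup.closure
        ({c | ∃ (r : IntegralRep 2) (e α β γ δ : ℚ), 0 < α ∧ 0 < α + β ∧ 0 < γ ∧ 0 < γ + δ ∧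
            r.domain = cube 2 ∧
            EqOn r.integrand (fun p => (e : ℝ) / (((α : ℝ) + β * p 0) * ((γ : ℝ) + δ * p 1))) (cube 2) ∧
            c = KZ.of r} ∪
          {c | ∃ (r : IntegralRep 2) (e : ℚ), r.domain = cube 2 ∧
            EqOn r.integrand (fun p => (e : ℝ) / (1 + p 0 * p 1)) (cube 2) ∧ c = KZ.of r}),
        KZ.eval ((∑ i, n i • KZ.of (r i)) + w) = 0 →
        ∀ u v : Additive ℚˣ →+ ℚ, blochPairing u v
          (∑ i, n i • FreeAbelianGroup.of (⟨x i, (hx i).2, (hx i).1.ne⟩ : PreBloch.Gen ℚ)) = 0) →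
    (∀ w ∈ AddSubgroup.closure
        ({c | ∃ (r : IntegralRep 2) (e α β γ δ : ℚ), 0 < α ∧ 0 < α + β ∧ 0 < γ ∧ 0 < γ + δ ∧
            r.domain = cube 2 ∧
            EqOn r.integrand (fun p => (e : ℝ) / (((α : ℝ) + β * p 0) * ((γ : ℝ) + δ * p 1))) (cube 2) ∧
            c = KZ.of r} ∪
          {c | ∃ (r : IntegralRep 2) (e : ℚ), r.domain = cube 2 ∧
            EqOn r.integrand (fun p => (e : ℝ) / (1 + p 0 * p 1)) (cube 2) ∧ c = KZ.of r}),
        KZ.eval w = 0 → w ∈ KZ.relations) →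
    ∀ c ∈ AddSubgroup.closure
      ({c | ∃ (z : ℚ) (r : IntegralRep 2), z < 1 ∧ z ≠ 0 ∧ r.domain = cube 2 ∧
          EqOn r.integrand (fun p => (z : ℝ) / (1 - (z : ℝ) * p 0 * p 1)) (cube 2) ∧ c = KZ.of r} ∪
        ({c | ∃ (r : IntegralRep 2) (e α β γ δ : ℚ), 0 < α ∧ 0 < α + β ∧ 0 < γ ∧ 0 < γ + δ ∧
            r.domain = cube 2 ∧
            EqOn r.integrand (fun p => (e : ℝ) / (((α : ℝ) + β * p 0) * ((γ : ℝ) + δ * p 1))) (cube 2) ∧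
            c = KZ.of r} ∪
          {c | ∃ (r : IntegralRep 2) (e : ℚ), r.domain = cube 2 ∧
            EqOn r.integrand (fun p => (e : ℝ) / (1 + p 0 * p 1)) (cube 2) ∧ c = KZ.of r})),
      KZ.eval c = 0 → c ∈ KZ.relations := by
  intro hS hrigA hrigW c hc h0
  obtain ⟨k, z, n, ρ, hfam, w, hw, rfl⟩ := stub_dilogSectorPresentation c hc
  have hD := hrigA k z n ρ (fun i => ⟨(hfam i).1, (hfam i).2.1⟩) (fun i => (hfam i).2.2) w hw h0
  have hred := stub_dehnClosedReduces hS k z n ρ (fun i => ⟨(hfam i).1, (hfam i).2.1⟩) (fun i => (hfam i).2.2)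
    hD
  obtain ⟨y, hy, w', hw', hyw⟩ := AddSubgroup.mem_sup.1 hred
  have hval : KZ.eval (w' + w) = 0 := by
    have hy0 : KZ.eval y = 0 := eval_eq_zero_of_mem_relations hy
    rw [← hyw, map_add, map_add, hy0, zero_add] at h0
    rwa [map_add]
  have hW := hrigW (w' + w) (add_mem hw' hw) hval
  rw [← hyw, add_assoc]
  exact KZ.relations.add_mem hy hW


end Summit.KontsevichZagierPeriods.HermiteRigidity.ReductionRigidity

end
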